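import Summits.QuantumFields.QCD.Theorems.PauliWegnerSeaChiralGluonicCompletionDefs
import Summits.QuantumFields.QCD.Theorems.QuarksNoInfraredClauseThinQCDStubUvWindowLaw
import HarnessLib

/-!
# Crux `ChiralGluonicCompletion` (stmt-QuantumFields-17498), line `goldstone_split` — stub 3b:
# the CLOSED diagonal step `stub_packageContinuum_of_compactnessReady` (lead c10, 2026-08-17)

Skeleton rev 2 of the registered line `Cruxes/ChiralGluonicCompletion/Lines/goldstone_split.lean` reshapes the pin-free
continuum stub `stub_packageContinuum` (= child `PackageContinuum` of the prepared split: for `N_f ∈ {2,3}`, every AF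
mass-scaling regularisation carrying the per-mass package and a lattice gap at every positive tuple has ONE subsequence
along which, at every positive tuple, the continuum body of `QCDOf` holds) into

* `stub_packageCompactnessReady` (OPEN, registered): species renormalisations `z m, shift m` chosen
  mass-equicontinuously (`IsMassEquicontinuous`), k-eventual bounds on a COUNTABLE family of test data at every positive
  tuple, and the closure clause (along every strictly increasing `φ` on which the countable family converges there are OS
  data `T` with full convergence on off-diagonal real tensors, non-triviality ×3 and a mass gap) — the shape of
  `ThinQCD`'s compactness-ready stub (crux stmt-QuantumFields-17278);
* THIS FILE, `stub_packageContinuum_of_compactnessReady` (registered sub-goal, sorry-free): the bundle implies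
  `PackageContinuum`.  Proof: ONE strictly increasing `φ` serves every positive tuple and every test datum
  (`ThinQCD.Registered.exists_strictMono_forall_mass_tendsto` — Tychonoff over the countable family × a countable dense set
  of positive tuples, `ε/3` from the mass modulus); at each tuple the closure clause supplies `T`; `IsQCDAlong` along
  `reg.restrict φ` with the reindexed species data IS convergence along `φ` (`isQCDAlong_restrict_scheme`), the physical
  branch being clause (i) of the per-mass package (`QCDRegularisation.scheme_mq`).

So after this file child `PackageContinuum` owes exactly the compactness-ready bundle: k-uniform bounds
(`DiagonalSpine.CalibratedTightness`-type), the mass modulus (`DiagonalSpine.MassEquicontinuity`-type), and the closure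
clause, whose OS half is served scheme-generically by `ConvergentOSClosure.stub_closureOfLatticeInputs` /
`exists_osData_qcd_of_package` from the lattice-side inputs T ∧ COMP, CL, CS, the three floors and E1.
No definition, no named fact, no `sorry`.
-/

noncomputable section

namespace Summit.QuantumFields.QCD.Theorems.GoldstoneSplit

open scoped SchwartzMap Topology
open MeasureTheory Filter
open Literature.MathematicalPhysics.QuantumFieldTheory Literature.MathematicalPhysics.QuantumLattice
  Literature.MathematicalPhysics.AQFT Literature.Probability.LatticeModels
open Summit.QuantumFields.QCD.Theorems.StronglyChiralSubsequence
open Summit.QuantumFields.QCD.Cruxes.ThinQCD.Registered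

/-- **Registered sub-goal `stub_packageContinuum_of_compactnessReady` (stub 3b of line `goldstone_split`): the
compactness-ready bundle implies `PackageContinuum`.**  If for `N_f ∈ {2,3}` every AF mass-scaling regularisation `reg`
carrying the per-mass package and a lattice gap at every positive tuple admits species renormalisations `z m, shift m`
(mass-equicontinuous), a countable family of test data with k-eventual bounds at every positive tuple, and the closure
clause (every strictly increasing `φ` along which the countable family converges carries OS data `T` with full
convergence on off-diagonal real tensors, non-trivial non-Gaussian glue, dynamical flavour-changing pseudoscalars and a
mass gap), then such a `reg` has ONE strictly increasing `φ` along which `ContinuumBody N_f (reg.restrict φ) m` holds at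
every positive tuple `m`. [cite: OsterwalderSchraderCMP1975, §2, §4] -/
theorem stub_packageContinuum_of_compactnessReady : (∀ Nf : ℕ, Nf = 2 ∨ Nf = 3 → ∀ reg : QCDRegularisation Nf, reg.HasMassScaling → (reg.scheme 0 0 0).HasAsymptoticScaling → (∀ m : Fin Nf → ℝ, (∀ f, 0 < m f) → PerMass Nf reg m) → (∀ m : Fin Nf → ℝ, (∀ f, 0 < m f) → ∃ Δ > 0, (reg.scheme m 0 0).HasLatticeMassGap Δ) → ∃ (z shift : (Fin Nf → ℝ) → QCDField Nf → ℕ → ℝ) (ι : Type) (_ : Countable ι) (n : ι → ℕ) (σ : (i : ι) → Fin (n i) → QCDField Nf) (f : (i : ι) → Fin (n i) → SchwartzMap (EuclideanSpace ℝ (Fin 4)) ℝ), (∀ i, n i ≠ 0) ∧ IsMassEquicontinuous reg z shift ∧ (∀ i, ∀ m : Fin Nf → ℝ, (∀ fl, 0 < m fl) → ∃ R : ℝ, ∀ᶠ k in atTop, ‖qcdLatticeSchwinger (reg.scheme m (z m) (shift m)) k (n i) (σ i) (f i)‖ ≤ R) ∧ (∀ m : Fin Nf → ℝ, (∀ fl,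 0 < m fl) → ∀ φ : ℕ → ℕ, StrictMono φ → (∀ i, ∃ l : ℂ, Tendsto (fun k => qcdLatticeSchwinger (reg.scheme m (z m) (shift m)) (φ k) (n i) (σ i) (f i)) atTop (𝓝 l)) → ∃ T : OSData (QCDField Nf) 4, (∀ n' : ℕ, n' ≠ 0 → ∀ (σ' : Fin n' → QCDField Nf) (f' : Fin n' → SchwartzMap (EuclideanSpace ℝ (Fin 4)) ℝ) (F : SchwartzMap (Fin n' → EuclideanSpace ℝ (Fin 4)) ℂ), IsTensorOf F (fun i => ofRealTest (f' i)) → IsOffDiagonal F → Tendsto (fun k => qcdLatticeSchwinger (reg.scheme m (z m) (shift m)) (φ k) n' σ' f') atTop (𝓝 (T.schwinger n' σ' F))) ∧ T.IsNontrivial QCDField.glue ∧ T.IsNonGaussian QCDField.glue ∧ (∀ f g : Fin Nf, f ≠ g → T.IsNontrivial (QCDField.pseudoRe f g)) ∧ ∃ Δ > 0, T.HasMassGap Δ)) → ∀ Nf : ℕ, Nf = 2 ∨ Nf = 3 → ∀ reg : QCDRegularisation Nf, reg.HasMassScaling → (reg.scheme 0 0 0).HasAsymptoticScaling → (∀ m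 : Fin Nf → ℝ, (∀ f, 0 < m f) → PerMass Nf reg m) → (∀ m : Fin Nf → ℝ, (∀ f, 0 < m f) → ∃ Δ > 0, (reg.scheme m 0 0).HasLatticeMassGap Δ) → ∃ φ : ℕ → ℕ, ∃ hφ : StrictMono φ, ∀ m : Fin Nf → ℝ, (∀ f, 0 < m f) → ContinuumBody Nf (reg.restrict φ hφ.tendsto_atTop) m := by
  intro hR Nf hNf reg hMS hAS hper hgap
  obtain ⟨z, shift, ι, hι, n, σ, f, hn, hE, hb, hC⟩ := hR Nf hNf reg hMS hAS hper hgap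
  haveI : Countable ι := hι
  obtain ⟨φ, hφ, hlim⟩ :=
    exists_strictMono_forall_mass_tendsto reg z shift hE n hn σ f hb
  refine ⟨φ, hφ, fun m hm => ?_⟩
  obtain ⟨T, hTconv, hN, hG, hP, hΔ⟩ := hC m hm φ hφ (hlim m hm)
  have hbr : ∀ fl, ∀ᶠ k in atTop, (-1 : ℝ) < (reg.scheme m 0 0).mq fl k := fun fl => by
    simpa only [QCDRegularisation.scheme_mq] using (hper m hm).1.1 fl
  exact ⟨fun s j => z m s (φ j), fun s j => shift m s (φ j), T,
    isQCDAlong_restrict_scheme reg φ hφ.tendsto_atTop hAS hbr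
      (z m) (shift m) T hTconv, hN, hG, hP, hΔ⟩

end Summit.QuantumFields.QCD.Theorems.GoldstoneSplit

end
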